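import Summits.SmoothPoincare4.SmoothPoincare4.Theorems.EntropyRungConicalGapThinCone
import Literature.Geometry.Lorentzian.VolumePositivity
import HarnessLib

/-!
# Crux `EntropyRung.ConicalGap` (stmt-SmoothPoincare4-16589), line `Sketch`: rigidity `AVR < Θ` on non-flat shrinkers

The landed density transform (`EntropyRungConicalGapReduction.lean`, `helper_densityTransform`) reads
`∫ e^{-f} dV = 16π² a + ∫ R k(f) dV` with `k(t) = ∫₁^∞ (τ − 1) τ⁻⁴ e^{-t/τ} dτ`; `helper_avr_le_density` gave
`16π² a ≤ ∫ e^{-f} dV`. Here the **rigidity half of Wang–Wang 2023 Thm 1.1** (arXiv:2308.06560: `AVR ≤ Θ`, with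
equality only on the Gaussian soliton) in the tree's vocabulary: the kernel `k` is POSITIVE
(`densityTransform_kernel_integral_pos`), so on a NON-FLAT complete connected normalised 4-d gradient shrinker
(`∃ x, R x ≠ 0`; `R ≥ 0` by Zhang, `R` continuous, `dV` positive on non-empty open sets —
`isOpenPosMeasure_riemannianMeasure`) the core term `∫ R k(f) dV` is POSITIVE and

* `helper_avr_lt_density_of_nonflat` — `16π² a < ∫ e^{-f} dV` for the regularised asymptotic volume ratio `a`;
* `helper_sublevelAvr_lt_density_of_nonflat` — the same for the classical sublevel ratio
  `A = lim Vol{f < t}/(8π²t²)` whenever it exists (`helper_avr_eq_sublevelLimit`): `16π² A < ∫ e^{-f} dV`.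

(Flatness `R ≡ 0` ⇒ Gaussian soliton is a separate classical fact and is not used or claimed here.)
Everything here is proved; no definition and no named fact is introduced.
-/

noncomputable section

-- `Summit.SmoothPoincare4.SmoothPoincare4.…` (summit = problem) trips `dupNamespace` on every decl.
set_option linter.dupNamespace false

open scoped Manifold ContDiff ENNReal NNReal Topology
open MeasureTheory Set Filter
open Literature.Geometry.Lorentzian Literature.Geometry.Riemannian

namespace Summit.SmoothPoincare4.SmoothPoincare4.Theorems.ConicalGapSketch

/-- The transform kernel is POSITIVE: `k(t) = ∫₁^∞ (τ − 1) τ⁻⁴ e^{-t/τ} dτ > 0` for `t ≥ 0` (the integrand is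
positive on the set `(1, ∞)` of positive Lebesgue measure and integrable there, `transformKernel_integrableOn`). -/
theorem densityTransform_kernel_integral_pos {t : ℝ} (ht : 0 ≤ t) :
    0 < ∫ τ in Set.Ioi (1 : ℝ), (τ - 1) / τ ^ 4 * Real.exp (-t / τ) := by
  have hint := transformKernel_integrableOn ht
  rw [setIntegral_pos_iff_support_of_nonneg_ae
    ((ae_restrict_mem measurableSet_Ioi).mono fun τ hτ ↦ transformKernel_nonneg t (mem_Ioi.1 hτ).le) hint]
  have hsub : Ioi (1 : ℝ) ⊆ Function.support (fun τ : ℝ ↦ (τ - 1) / τ ^ 4 * Real.exp (-t / τ)) ∩ Ioi 1 := by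
    intro τ hτ
    refine ⟨?_, hτ⟩
    have h1 : (1 : ℝ) < τ := hτ
    exact (mul_pos (div_pos (by linarith) (by positivity)) (Real.exp_pos _)).ne'
  calc (0 : ℝ≥0∞) < volume (Ioi (1 : ℝ)) := by simp
    _ ≤ volume (Function.support (fun τ : ℝ ↦ (τ - 1) / τ ^ 4 * Real.exp (-t / τ)) ∩ Ioi 1) :=
        measure_mono hsub

/-- **Rigidity `16π² a < ∫ e^{-f} dV` on a non-flat shrinker** (the strict half of Wang–Wang 2023 Thm 1.1 in
regularised form): on a complete connected normalised 4-d gradient shrinker with `R x₀ ≠ 0` somewhere, the core term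
`∫ R k(f) dV` of the density transform is positive — `R ≥ 0` continuous and positive on a non-empty open set of
positive `dV`-measure, `k(f) > 0` — so the regularised asymptotic volume ratio is STRICTLY below the Gaussian mass. -/
theorem helper_avr_lt_density_of_nonflat : ∀ (M : Type) [TopologicalSpace M] [T2Space M] [SecondCountableTopology M] [ChartedSpace (EuclideanSpace ℝ (Fin 4)) M] [IsManifold (𝓡 4) ∞ M] [ConnectedSpace M] [T3Space M] [MeasurableSpace M] [BorelSpace M] (g : Literature.Geometry.Lorentzian.PseudoRiemannianMetric (𝓡 4) ∞ (EuclideanSpace ℝ (Fin 4)) (TangentSpace (𝓡 4) : M → Type _)) [g.HasLeviCivita] (f : M → ℝ) (hg : g.IsRiemannian), (∀ (x : M) (r : NNReal), IsCompact {y : M | g.edist hg x y ≤ r}) → ContMDiff (𝓡 4) 𝓘(ℝ, ℝ) ∞ f → (∀ (x : M) (X Y : TangentSpace (𝓡 4) x), g.ricci x X Y + g.hessian f x X Y = (1 / 2 : ℝ) * g.val x X Y) → (∀ x : M, g.scalarCurvature x + g.gradSq f x = f x) → (∃ x : M, g.scalarCurvature x ≠ 0) → ∀ a : ℝ, Filter.Tendsto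 (fun T : ℝ ↦ (16 * Real.pi ^ 2 * T ^ 2)⁻¹ * ∫ x, Real.exp (-f x / T) ∂(Literature.Geometry.Lorentzian.riemannianMeasure (g.toContMDiffRiemannianMetric hg))) Filter.atTop (nhds a) → 16 * Real.pi ^ 2 * a < ∫ x, Real.exp (-f x) ∂(Literature.Geometry.Lorentzian.riemannianMeasure (g.toContMDiffRiemannianMetric hg)) := by
  intro M _ _ _ _ _ _ _ _ _ g _ f hg hc hf hsol hnorm hnf a ha
  have hR0 : ∀ x, 0 ≤ g.scalarCurvature x :=
    shrinkerScalarCurvature_nonneg_holds 4 M g f hg hc hf hsol hnorm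
  have hf0 : ∀ x, 0 ≤ f x := fun x ↦ by
    have h1 := hnorm x
    have h2 := g.gradSq_nonneg hg f x
    linarith [hR0 x]
  have hRc : Continuous fun x ↦ g.scalarCurvature x :=
    (PseudoRiemannianMetric.contMDiff_scalarCurvature g).continuous
  obtain ⟨a', -, hlim, hint, hZ⟩ := helper_densityTransform M g f hg hc hf hsol hnorm
  have haa : a = a' := tendsto_nhds_unique ha hlim
  subst haa
  rw [hZ]
  -- the core term is positive
  set G : M → ℝ := fun x ↦ g.scalarCurvature x *
    ∫ τ in Set.Ioi (1 : ℝ), (τ - 1) / τ ^ 4 * Real.exp (-f x / τ) with hG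
  have hG0 : ∀ x, 0 ≤ G x :=
    fun x ↦ mul_nonneg (hR0 x) (densityTransform_kernel_integral_nonneg (f x))
  have hsupp : {x | 0 < g.scalarCurvature x} ⊆ Function.support G := fun x hx ↦
    (mul_pos hx (densityTransform_kernel_integral_pos (hf0 x))).ne'
  have hopen : IsOpen {x | 0 < g.scalarCurvature x} := isOpen_lt continuous_const hRc
  obtain ⟨x₀, hx₀⟩ := hnf
  have hne : ({x | 0 < g.scalarCurvature x} : Set M).Nonempty := ⟨x₀, (hR0 x₀).lt_of_ne' hx₀⟩
  haveI : (riemannianMeasure (g.toContMDiffRiemannianMetric hg)).IsOpenPosMeasure :=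
    isOpenPosMeasure_riemannianMeasure (g.toContMDiffRiemannianMetric hg)
  have hpos : 0 < ∫ x, G x ∂(riemannianMeasure (g.toContMDiffRiemannianMetric hg)) := by
    rw [integral_pos_iff_support_of_nonneg hG0 hint]
    exact (hopen.measure_pos _ hne).trans_le (measure_mono hsupp)
  linarith

/-- **Rigidity in classical form**: on a NON-FLAT complete connected normalised 4-d gradient shrinker whose sublevel
volume ratio `Vol{f < t}/(8π²t²)` converges to `A`, `16π² A < ∫ e^{-f} dV` (`AVR < Θ`; Wang–Wang 2023 Thm 1.1, strict
case) — `helper_avr_eq_sublevelLimit` + `helper_avr_lt_density_of_nonflat`. -/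
theorem helper_sublevelAvr_lt_density_of_nonflat : ∀ (M : Type) [TopologicalSpace M] [T2Space M] [SecondCountableTopology M] [ChartedSpace (EuclideanSpace ℝ (Fin 4)) M] [IsManifold (𝓡 4) ∞ M] [ConnectedSpace M] [T3Space M] [MeasurableSpace M] [BorelSpace M] (g : Literature.Geometry.Lorentzian.PseudoRiemannianMetric (𝓡 4) ∞ (EuclideanSpace ℝ (Fin 4)) (TangentSpace (𝓡 4) : M → Type _)) [g.HasLeviCivita] (f : M → ℝ) (hg : g.IsRiemannian), (∀ (x : M) (r : NNReal), IsCompact {y : M | g.edist hg x y ≤ r}) → ContMDiff (𝓡 4) 𝓘(ℝ, ℝ) ∞ f → (∀ (x : M) (X Y : TangentSpace (𝓡 4) x), g.ricci x X Y + g.hessian f x X Y = (1 / 2 : ℝ) * g.val x X Y) → (∀ x : M, g.scalarCurvature x + g.gradSq f x = f x) → (∃ x : M, g.scalarCurvature x ≠ 0) → ∀ A : ℝ, Filter.Tendsto (fun t : ℝ ↦ ((Literature.Geometry.Lorentzian.riemannianMeasure (g.toContMDiffRiemannianMetric hg)) {x | f x < t}).toReal / (8 * Real.pi ^ 2 * t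 ^ 2)) Filter.atTop (nhds A) → 16 * Real.pi ^ 2 * A < ∫ x, Real.exp (-f x) ∂(Literature.Geometry.Lorentzian.riemannianMeasure (g.toContMDiffRiemannianMetric hg)) := by
  intro M _ _ _ _ _ _ _ _ _ g _ f hg hc hf hsol hnorm hnf A hA
  have hR0 : ∀ x, 0 ≤ g.scalarCurvature x :=
    shrinkerScalarCurvature_nonneg_holds 4 M g f hg hc hf hsol hnorm
  have hf0 : ∀ x, 0 ≤ f x := fun x ↦ by
    have h1 := hnorm x
    have h2 := g.gradSq_nonneg hg f x
    linarith [hR0 x]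
  have hint : ∀ T : ℝ, 0 < T → Integrable (fun x ↦ Real.exp (-f x / T))
      (riemannianMeasure (g.toContMDiffRiemannianMetric hg)) :=
    fun T hT ↦ (stub_weightedIntegrability M g f hg hc hf hsol hnorm T hT).1
  have ha : Tendsto (fun T : ℝ ↦ (16 * Real.pi ^ 2 * T ^ 2)⁻¹ *
      ∫ x, Real.exp (-f x / T) ∂(riemannianMeasure (g.toContMDiffRiemannianMetric hg))) atTop (𝓝 A) :=
    helper_avr_eq_sublevelLimit M (riemannianMeasure (g.toContMDiffRiemannianMetric hg)) f
      hf.continuous.measurable hf0 hint A hA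
  exact helper_avr_lt_density_of_nonflat M g f hg hc hf hsol hnorm hnf A ha

end Summit.SmoothPoincare4.SmoothPoincare4.Theorems.ConicalGapSketch

end
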